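import Literature.MathematicalPhysics.QuantumFieldTheory.Balaban1983to89.Beta.RemainderKernelNeumann

/-!
# [Balaban1985Variational] Sect. G (188): *"Thus Eq. (184) can be solved by the Neumann series expansion"* — EXISTENCE
# of the bounded solution of `a + k∘a = s` for decaying `ℤ^d` kernels, so that (184) is SOLVED at the kernel level
# (`Beta.RemainderKernelNeumannExistence`)

statement-level skeleton of published theorems with citation tags; proofs where landed; nothing here is a claim
about the Yang–Mills mass gap.

HONEST FRAMING (cell rule).  Bookkeeping for the k-uniform remainder chain of row (D4) (`RemainderConst` ⇐ ONE
`ChainTFac190` instance, `Beta.RemainderDecay190`); discharges NOTHING of `BetaPertH`; NOT B12 Thm 2, NOT the continuum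
limit, NOT Clay.  Unit `b2b-balaban-beta-an4` gen 97 (BINDER row D4 OWNER; cell pub-balaban).  Imports
`Beta.RemainderKernelNeumann` (this generation: the row estimate, `decay₂_neumann`, `eq_of_fix`, `isPeriodic₂_of_fix`,
`decay₂_of_eq184`, `isPeriodic₂_of_eq184`) ONLY; nothing edited.  [folklore] real analysis (Banach's fixed point on the
bounded kernels).

WHY.  `RemainderKernelNeumann.decay₂_of_eq184` turns the decay letter of the (182)-piece `a₀` into an OUTPUT of
(184) + (189), but still takes the SUBJECT `a₀` together with its a-priori sup bound (188) as inputs.  In print (188) is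
itself a consequence of the smallness (187): *"hence the norm of the linear operator is small also. Thus Eq. (184) can be
solved by the Neumann series expansion"* ([15] p. 308).  THIS FILE proves that consequence at the kernel level: under
`θ·K₁(d, δ) < 1` (the `ℓ^∞ → ℓ^∞` norm of `k` is `< 1`) the equation `a + k∘a = s` with bounded `s` HAS a bounded solution
(Banach's fixed point theorem on the complete space of bounded functions `ℤ^d × ℤ^d → ℝ`, the Picard map being a
`θK₁(δ)`-contraction by the row estimate), unique by `eq_of_fix`, with the bound `|a| ≤ A(1 − θK₁(δ))⁻¹`.  Consequently
(184) is SOLVED: from the four primitive pieces `g̃, w, Δ⁽²⁾h₀, h₀` and ONE smallness there EXISTS a kernel `a₀` satisfying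
(184), bounded ((188)), decaying at `⅛δ₀` ((190)-type) and block-periodic whenever the pieces are — the model road's piece
`a₀` with ALL its letters (`ha`, `pa`) is an OUTPUT; what the builder supplies about 𝔄₀ is nothing but the identification
of Bałaban's (δ∕δB)𝒜₀ with (the periodisations of) this solution, which by uniqueness amounts to (184) + boundedness for
his kernel.

WHAT.  §1 **`exists_bounded_fix`** (`Decay₂ k θ δ`, `δ > 0`, `|s| ≤ A`, `θK₁(δ) < 1` ⟹ `∃ a, (∀ x y, a x y + (k∘a) x y
= s x y) ∧ ∀ x y, |a x y| ≤ A(1 − θK₁(δ))⁻¹`), **`exists_decaying_fix`** (the packaged form: existence + decay at the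
rate of `s` + inherited periodicity — serves (184) and [15] (68)∕(70)–(73) for 𝔇 alike); §2 **`exists_eq184`** — (184) SOLVED with the letters of the model road:
existence, the (188) bound, `Decay₂ a₀ · (δ₀∕8)` (by `decay₂_of_eq184`) and periodicity from periodic pieces (by
`isPeriodic₂_of_eq184`), under the single smallness `B_Gθ_W·K₁(δ₀ − ¼δ₀)·K₁(¼δ₀ − ⅛δ₀) < 1`; `eq184_unique` (any
bounded kernel satisfying (184) IS that solution); §3 `compKer_kdelta_add_left`, **`exists_green_of_perturbation`** — the
`ℤ^d` Green's function of `δ + k` (`k` decaying, `θK₁(δ∕2) < 1`) EXISTS, decays at `δ∕2` and inherits block-periodicity: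
the labelled input `compKer T S = kdelta ∧ Decay₂ S ∧ IsPeriodic₂` of `Beta.EntrywiseVolumeLimit` §4 DISCHARGED for
perturbations of the identity; §4 **`exists_eq68`** — [15] (68) ⇒ (70) + (73) for the piece `𝔡` = 𝔇 = (δ∕δA′)D:
from the local kernel `c′ = L^jη(δ∕δA)C_j(·)` and `h` (both rate δ₀) and `θ_cA_H·K₁(¼δ₀)² < 1`, `𝔡` EXISTS with
`𝔡 + (c′∘h)∘𝔡 = c′`, decays at print's rate ½δ₀ and inherits block-periodicity — so of the model road's pieces only
`g̃, w, Δ⁽²⁾h₀, h₀, h, c′` are primitive, `a₀` and `𝔡` being Neumann outputs.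
WHAT IS *NOT* DONE: (189) (the decay of `w`) and the decay of `g̃`, `Δ⁽²⁾h₀`, `h₀` are INPUTS (print proves the latter
three in [15] §§E–F for Bałaban's operators — NODE O); nothing of Bałaban's is constructed; row D4 class UNCHANGED
(instance 0∕1; critical-path width 0 = NODE O; D4 DISCHARGE NO DATE).  No `def`, no named fact, no `sorry`, standard
axioms.
HONEST DEPENDENCY: continuum YM on T⁴ ⇐ BetaPertH ∧ nine spine estimates (0/9 proved); BetaPertH ⇐ (D1) ∧ (D4) ∧
CAP+tail; G-an2-4 gates asym, D1 and NE2/3/4.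

Sources: [15] = T. Bałaban, Commun. Math. Phys. **102** (1985) 277–309 [Balaban1985Variational], (184) p. 307, (187)–(190)
p. 308; [3] = Commun. Math. Phys. **96** (1984) [Balaban1984PropagatorsII], Lemma 2.1 p. 234.
-/

namespace Literature.MathematicalPhysics.QuantumFieldTheory.Balaban1983to89.Beta.RemainderKernelNeumannExistence

open Literature.MathematicalPhysics.QuantumFieldTheory.Balaban1983to89
open Literature.MathematicalPhysics.QuantumFieldTheory.Balaban1983to89.B12Sec2to5 (l1 l1_nonneg)
open Literature.MathematicalPhysics.QuantumFieldTheory.Balaban1983to89.B12Decay510Window (K₁ K₁_nonneg)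
open Literature.MathematicalPhysics.QuantumFieldTheory.Balaban1983to89.Beta
  (Kernel₂ Decay₂ IsPeriodic₂ compKer kdelta isPeriodic₂_kdelta)
open Literature.MathematicalPhysics.QuantumFieldTheory.Balaban1983to89.Beta.RemainderKernelNeumann
  (K₁_anti abs_compKer_le_of_col_le decay₂_neumann compKer_sub_right summable_mul_of_col_bounded eq_of_fix
    isPeriodic₂_of_fix decay₂_of_eq184 isPeriodic₂_of_eq184)
open BoundedContinuousFunction

variable {d : ℕ}

/-! ## §1. Banach's fixed point on the bounded kernels: the bounded solution EXISTS -/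

/-- **(188): THE EQUATION `a + k∘a = s` HAS A BOUNDED SOLUTION** when `|k(x,y)| ≤ θe^{−δ|x−y|₁}` (`δ > 0`),
`|s(x,y)| ≤ A` and `θ·K₁(d, δ) < 1` — *"hence the norm of the linear operator is small also. Thus Eq. (184) can be solved by
the Neumann series expansion"*.  Proof: the Picard map `f ↦ s − k∘f` is a `θK₁(δ)`-contraction of the complete space of
bounded functions on `ℤ^d × ℤ^d` (the row estimate `RemainderKernelNeumann.abs_compKer_le_of_col_le` at `ρ = 0`); its
fixed point is the solution, and `decay₂_neumann` at `ρ = 0` gives the bound `A(1 − θK₁(δ))⁻¹`.  Unique among bounded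
kernels by `RemainderKernelNeumann.eq_of_fix`. [cite: Balaban1985Variational, (187)–(188) p.308; Balaban1984PropagatorsII, Lemma 2.1 p.234] -/
theorem exists_bounded_fix {k s : Kernel₂ d} {θ δ A : ℝ} (hk : Decay₂ k θ δ) (hδ : 0 < δ)
    (hs : ∀ x y, |s x y| ≤ A) (hq : θ * K₁ d δ < 1) :
    ∃ a : Kernel₂ d, (∀ x y, a x y + compKer k a x y = s x y) ∧
      ∀ x y, |a x y| ≤ A * (1 - θ * K₁ d δ)⁻¹ := by
  classical
  have hθ : 0 ≤ θ := hk.constant_nonneg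
  have hA : 0 ≤ A := (abs_nonneg _).trans (hs 0 0)
  have hq0 : 0 ≤ θ * K₁ d δ := mul_nonneg hθ (K₁_nonneg _ _)
  -- the Picard map on functions of the pair (x, y)
  let P : (((Fin d → ℤ) × (Fin d → ℤ)) → ℝ) → ((Fin d → ℤ) × (Fin d → ℤ)) → ℝ :=
    fun f p => s p.1 p.2 - compKer k (fun u v => f (u, v)) p.1 p.2
  -- it maps bounded functions to bounded functions: |P f| ≤ A + θK₁(δ)‖f‖
  have hP : ∀ f : ((Fin d → ℤ) × (Fin d → ℤ)) →ᵇ ℝ, ∀ p, ‖P f p‖ ≤ A + θ * K₁ d δ * ‖f‖ := by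
    intro f p
    have hcol : ∀ z, |(fun u v => f (u, v)) z p.2| ≤ 0 * Real.exp (-0 * l1 (z - p.2)) + ‖f‖ := fun z => by
      rw [zero_mul, zero_add, ← Real.norm_eq_abs]
      exact f.norm_coe_le_norm (z, p.2)
    have h := abs_compKer_le_of_col_le (a := fun u v => f (u, v)) hk le_rfl hδ le_rfl p.2 hcol p.1
    rw [Real.norm_eq_abs]
    calc |P f p| ≤ |s p.1 p.2| + |compKer k (fun u v => f (u, v)) p.1 p.2| := abs_sub _ _
      _ ≤ A + θ * (0 * K₁ d (δ - 0) * Real.exp (-0 * l1 (p.1 - p.2)) + ‖f‖ * K₁ d δ) := add_le_add (hs _ _) h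
      _ = A + θ * K₁ d δ * ‖f‖ := by ring
  let T : (((Fin d → ℤ) × (Fin d → ℤ)) →ᵇ ℝ) → ((Fin d → ℤ) × (Fin d → ℤ)) →ᵇ ℝ :=
    fun f => ofNormedAddCommGroupDiscrete (P f) (A + θ * K₁ d δ * ‖f‖) (hP f)
  have hT : ∀ (f : ((Fin d → ℤ) × (Fin d → ℤ)) →ᵇ ℝ) p, T f p = P f p := fun f p => rfl
  -- it is a θK₁(δ)-contraction
  have hlip : ∀ f g : ((Fin d → ℤ) × (Fin d → ℤ)) →ᵇ ℝ, dist (T f) (T g) ≤ θ * K₁ d δ * dist f g := by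
    intro f g
    refine (dist_le (mul_nonneg hq0 dist_nonneg)).mpr fun p => ?_
    rw [hT, hT, Real.dist_eq]
    have hf : ∀ u v, |(fun u v => f (u, v)) u v| ≤ ‖f‖ := fun u v => by
      rw [← Real.norm_eq_abs]; exact f.norm_coe_le_norm (u, v)
    have hg : ∀ u v, |(fun u v => g (u, v)) u v| ≤ ‖g‖ := fun u v => by
      rw [← Real.norm_eq_abs]; exact g.norm_coe_le_norm (u, v)
    have e : P f p - P g p = -compKer k (fun u v => (fun u v => f (u, v)) u v - (fun u v => g (u, v)) u v) p.1 p.2 := by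
      rw [compKer_sub_right hk hδ hf hg]
      simp only [P]
      ring
    have hcol : ∀ z, |(fun u v => (fun u v => f (u, v)) u v - (fun u v => g (u, v)) u v) z p.2| ≤
        0 * Real.exp (-0 * l1 (z - p.2)) + dist f g := fun z => by
      rw [zero_mul, zero_add, ← Real.dist_eq]
      exact f.dist_coe_le_dist (z, p.2)
    have h := abs_compKer_le_of_col_le (a := fun u v => (fun u v => f (u, v)) u v - (fun u v => g (u, v)) u v)
      hk le_rfl hδ le_rfl p.2 hcol p.1
    rw [e, abs_neg]
    calc _ ≤ θ * (0 * K₁ d (δ - 0) * Real.exp (-0 * l1 (p.1 - p.2)) + dist f g * K₁ d δ) := h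
      _ = θ * K₁ d δ * dist f g := by ring
  have hcw : ContractingWith ⟨θ * K₁ d δ, hq0⟩ T := by
    refine ⟨?_, LipschitzWith.of_dist_le_mul fun f g => ?_⟩
    · exact (NNReal.coe_lt_coe (r₁ := ⟨θ * K₁ d δ, hq0⟩) (r₂ := 1)).mp hq
    · exact hlip f g
  -- the fixed point is the solution
  have hfix := hcw.fixedPoint_isFixedPt
  set f₀ := ContractingWith.fixedPoint T hcw with hf₀
  refine ⟨fun u v => f₀ (u, v), fun x y => ?_, ?_⟩
  · have e := congrArg (fun h : ((Fin d → ℤ) × (Fin d → ℤ)) →ᵇ ℝ => h (x, y)) hfix.eq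
    simp only [hT, P] at e
    linarith
  · -- the bound: `decay₂_neumann` at ρ = 0 with the a-priori bound ‖f₀‖
    have hfixle : ∀ x y, |(fun u v => f₀ (u, v)) x y| ≤
        |s x y| + |compKer k (fun u v => f₀ (u, v)) x y| := by
      intro x y
      have e := congrArg (fun h : ((Fin d → ℤ) × (Fin d → ℤ)) →ᵇ ℝ => h (x, y)) hfix.eq
      simp only [hT, P] at e
      have e' : (fun u v => f₀ (u, v)) x y = s x y - compKer k (fun u v => f₀ (u, v)) x y := by
        show f₀ (x, y) = _
        linarith
      rw [e']
      exact abs_sub _ _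
    have hs' : Decay₂ s A 0 := fun x y => by
      rw [neg_zero, zero_mul, Real.exp_zero, mul_one]; exact hs x y
    have hM : ∀ x y, |(fun u v => f₀ (u, v)) x y| ≤ ‖f₀‖ := fun x y => by
      rw [← Real.norm_eq_abs]; exact f₀.norm_coe_le_norm (x, y)
    have hq' : θ * K₁ d (δ - 0) < 1 := by rwa [sub_zero]
    have h := decay₂_neumann hk hs' hM le_rfl hδ hfixle hq'
    intro x y
    have e := h x y
    rw [sub_zero, neg_zero, zero_mul, Real.exp_zero, mul_one] at e
    exact e

/-- **THE DECAYING SOLUTION, PACKAGED** — existence + decay + periodicity in one statement: for `|k| ≤ θe^{−δ|·|₁}`,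
`|s| ≤ Ae^{−ρ|·|₁}` (`0 ≤ ρ < δ`) and `q := θ·K₁(d, δ−ρ) < 1` there is a kernel `a` with `a + k∘a = s` entrywise,
`|a(x,y)| ≤ A(1−q)⁻¹e^{−ρ|x−y|₁}`, jointly `n`-periodic whenever `k` and `s` are; unique among bounded kernels
(`RemainderKernelNeumann.eq_of_fix`).  The shape serves (184) for 𝔄₀ AND [15] (68) for 𝔇 = (δ∕δA′)D alike
(p. 289: *"Equation (68) is uniquely solvable by a convergent Neumann series,"* (70), with the kernel bound (71) *"for ε₃
sufficiently small, which follows from Lemma 2.1 [3]"* and the decay (73)).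
[cite: Balaban1985Variational, (68) p.288, (70)–(73) p.289, (184) p.307, (187)–(188) p.308; Balaban1984PropagatorsII, Lemma 2.1 p.234] -/
theorem exists_decaying_fix {k s : Kernel₂ d} {θ δ A ρ : ℝ} (hk : Decay₂ k θ δ) (hs : Decay₂ s A ρ)
    (hρ : 0 ≤ ρ) (hρδ : ρ < δ) (hq : θ * K₁ d (δ - ρ) < 1) :
    ∃ a : Kernel₂ d, (∀ x y, a x y + compKer k a x y = s x y) ∧
      Decay₂ a (A * (1 - θ * K₁ d (δ - ρ))⁻¹) ρ ∧
      (∀ n : ℕ, IsPeriodic₂ n k → IsPeriodic₂ n s → IsPeriodic₂ n a) := by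
  have hθ : 0 ≤ θ := hk.constant_nonneg
  have hA : 0 ≤ A := hs.constant_nonneg
  have hδ : 0 < δ := lt_of_le_of_lt hρ hρδ
  have hq1 : θ * K₁ d δ < 1 :=
    lt_of_le_of_lt (mul_le_mul_of_nonneg_left (K₁_anti (by linarith) (by linarith)) hθ) hq
  have hsA : ∀ x y, |s x y| ≤ A := fun x y =>
    (hs x y).trans (mul_le_of_le_one_right hA (Real.exp_le_one_iff.mpr (by nlinarith [l1_nonneg (x - y)])))
  obtain ⟨a, hfix, hB⟩ := exists_bounded_fix hk hδ hsA hq1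
  have hfixle : ∀ x y, |a x y| ≤ |s x y| + |compKer k a x y| := fun x y => by
    have e : a x y = s x y - compKer k a x y := by linear_combination hfix x y
    rw [e]; exact abs_sub _ _
  exact ⟨a, hfix, decay₂_neumann hk hs hB hρ hρδ hfixle hq,
    fun n pk ps => isPeriodic₂_of_fix hk hδ pk ps hB hfix hq1⟩

/-! ## §2. (184) SOLVED at the kernel level -/

/-- **(184) SOLVED, WITH THE LETTERS OF THE MODEL ROAD.**  From the four primitive pieces — `g̃` (`B_G`, `δ₀`), `w` (`θ_W`,
`¼δ₀`) = (189), `Δ⁽²⁾h₀` (`c_Δ`, `δ₀`), `h₀` (`A₀`, `δ₀`), `δ₀ > 0` — and the ONE smallness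
`q_G := B_Gθ_W·K₁(δ₀ − ¼δ₀)·K₁(¼δ₀ − ⅛δ₀) < 1` ((187)): THERE EXISTS a kernel `a₀` on `ℤ^d` with
(i) the identity (184) `a₀ + (g̃∘w)∘a₀ = g̃∘Δ⁽²⁾h₀ − (g̃∘w)∘h₀`; (ii) the sup bound (188)
`|a₀| ≤ (B_Gc_ΔK₁(δ₀−¼δ₀) + B_Gθ_WK₁(δ₀−¼δ₀)·A₀·K₁(δ₀−¼δ₀))·(1 − B_Gθ_WK₁(δ₀−¼δ₀)·K₁(¼δ₀))⁻¹`; (iii) the decay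
`Decay₂ a₀ (C_𝔄(1−q_G)⁻¹) (δ₀∕8)` of `RemainderKernelNeumann.decay₂_of_eq184`; (iv) block-periodicity for every period
under which the four pieces are block-periodic.  (i)–(iv) are the letters `hA0`-side ∕ `ha` ∕ `pa` the model road
(`RemainderDecay190SupNormPieces`, `…Periodised`, `…PeriodisedEnd`) asks of the piece `a₀`.
[cite: Balaban1985Variational, (184) p.307, (187)–(190) p.308; Balaban1984PropagatorsII, Lemma 2.1 p.234] -/
theorem exists_eq184 {gt w d2h0 h0 : Kernel₂ d} {BG θW cΔ A₀ δ₀ : ℝ}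
    (hgt : Decay₂ gt BG δ₀) (hw : Decay₂ w θW (δ₀ / 4)) (hd2 : Decay₂ d2h0 cΔ δ₀) (hh0 : Decay₂ h0 A₀ δ₀)
    (hδ₀ : 0 < δ₀) (hq : BG * θW * K₁ d (δ₀ - δ₀ / 4) * K₁ d (δ₀ / 4 - δ₀ / 8) < 1) :
    ∃ a0 : Kernel₂ d,
      (∀ x y, a0 x y + compKer (compKer gt w) a0 x y = compKer gt d2h0 x y - compKer (compKer gt w) h0 x y) ∧
      (∀ x y, |a0 x y| ≤ (BG * cΔ * K₁ d (δ₀ - δ₀ / 4) + BG * θW * K₁ d (δ₀ - δ₀ / 4) * A₀ * K₁ d (δ₀ - δ₀ / 4)) *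
        (1 - BG * θW * K₁ d (δ₀ - δ₀ / 4) * K₁ d (δ₀ / 4))⁻¹) ∧
      Decay₂ a0 ((BG * cΔ * K₁ d (δ₀ - δ₀ / 8) + BG * θW * K₁ d (δ₀ - δ₀ / 4) * A₀ * K₁ d (δ₀ / 4 - δ₀ / 8)) *
        (1 - BG * θW * K₁ d (δ₀ - δ₀ / 4) * K₁ d (δ₀ / 4 - δ₀ / 8))⁻¹) (δ₀ / 8) ∧
      (∀ n : ℕ, IsPeriodic₂ n gt → IsPeriodic₂ n w → IsPeriodic₂ n d2h0 → IsPeriodic₂ n h0 → IsPeriodic₂ n a0) := by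
  have hBG : 0 ≤ BG := hgt.constant_nonneg
  have hθW : 0 ≤ θW := hw.constant_nonneg
  -- the kernel K = g̃∘w at rate ¼δ₀ and the bounded right-hand side
  have hK : Decay₂ (compKer gt w) (BG * θW * K₁ d (δ₀ - δ₀ / 4)) (δ₀ / 4) :=
    RemainderKernelNeumann.decay₂_compKer_left hgt hw (by linarith) (by linarith) le_rfl
  have hs1 : Decay₂ (compKer gt d2h0) (BG * cΔ * K₁ d (δ₀ - δ₀ / 4)) (δ₀ / 4) :=
    RemainderKernelNeumann.decay₂_compKer_left hgt hd2 (by linarith) (by linarith) (by linarith)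
  have hs2 : Decay₂ (compKer (compKer gt w) h0) (BG * θW * K₁ d (δ₀ - δ₀ / 4) * A₀ * K₁ d (δ₀ - δ₀ / 4))
      (δ₀ / 4) :=
    RemainderKernelDecay.decay₂_compKer hK hh0 (by linarith) le_rfl (by linarith)
  have hs := RemainderKernelNeumann.decay₂_sub hs1 hs2
  have hsA : ∀ x y, |compKer gt d2h0 x y - compKer (compKer gt w) h0 x y| ≤
      BG * cΔ * K₁ d (δ₀ - δ₀ / 4) + BG * θW * K₁ d (δ₀ - δ₀ / 4) * A₀ * K₁ d (δ₀ - δ₀ / 4) := fun x y =>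
    (hs x y).trans (mul_le_of_le_one_right hs.constant_nonneg
      (Real.exp_le_one_iff.mpr (by nlinarith [l1_nonneg (x - y)])))
  -- the weaker smallness for existence ∕ periodicity: K₁(¼δ₀) ≤ K₁(¼δ₀ − ⅛δ₀)
  have hKle : K₁ d (δ₀ / 4) ≤ K₁ d (δ₀ / 4 - δ₀ / 8) := K₁_anti (by linarith) (by linarith)
  have hq4 : BG * θW * K₁ d (δ₀ - δ₀ / 4) * K₁ d (δ₀ / 4) < 1 :=
    lt_of_le_of_lt (mul_le_mul_of_nonneg_left hKle (mul_nonneg (mul_nonneg hBG hθW) (K₁_nonneg _ _))) hq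
  obtain ⟨a0, h184, hM₀⟩ := exists_bounded_fix hK (by linarith) hsA hq4
  exact ⟨a0, h184, hM₀, decay₂_of_eq184 hgt hw hd2 hh0 hδ₀ hM₀ h184 hq,
    fun n pgt pw pd2 ph0 => isPeriodic₂_of_eq184 hgt hw hδ₀ pgt pw pd2 ph0 hM₀ h184 hq4⟩

/-- **UNIQUENESS FOR (184)**: any two BOUNDED kernels satisfying (184) with the same pieces coincide, under
`B_Gθ_W·K₁(δ₀ − ¼δ₀)·K₁(¼δ₀) < 1` — so Bałaban's (δ∕δB)𝒜₀, read as a bounded `ℤ^d` kernel obeying (184), IS the solution of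
`exists_eq184`. [cite: Balaban1985Variational, (184) p.307 and (188) p.308] -/
theorem eq184_unique {gt w d2h0 h0 a0 b0 : Kernel₂ d} {BG θW Ma Mb δ₀ : ℝ}
    (hgt : Decay₂ gt BG δ₀) (hw : Decay₂ w θW (δ₀ / 4)) (hδ₀ : 0 < δ₀)
    (ha : ∀ x y, |a0 x y| ≤ Ma) (hb : ∀ x y, |b0 x y| ≤ Mb)
    (ha184 : ∀ x y, a0 x y + compKer (compKer gt w) a0 x y = compKer gt d2h0 x y - compKer (compKer gt w) h0 x y)
    (hb184 : ∀ x y, b0 x y + compKer (compKer gt w) b0 x y = compKer gt d2h0 x y - compKer (compKer gt w) h0 x y)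
    (hq : BG * θW * K₁ d (δ₀ - δ₀ / 4) * K₁ d (δ₀ / 4) < 1) : a0 = b0 :=
  eq_of_fix (RemainderKernelNeumann.decay₂_compKer_left hgt hw (by linarith) (by linarith) le_rfl) (by linarith)
    ha hb ha184 hb184 hq

/-! ## §3. The `ℤ^d` Green's function of a small decaying perturbation of the identity -/

/-- `(δ + k)∘S = S + k∘S` entrywise for a decaying `k` and a BOUNDED `S` (the Kronecker row is a finite sum, the `k`-row
converges absolutely). [cite: Balaban1984PropagatorsII, Lemma 2.1 p.234] -/
theorem compKer_kdelta_add_left {k S : Kernel₂ d} {θ δ B : ℝ} (hk : Decay₂ k θ δ) (hδ : 0 < δ)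
    (hS : ∀ x y, |S x y| ≤ B) (x y : Fin d → ℤ) :
    compKer (kdelta + k) S x y = S x y + compKer k S x y := by
  classical
  have h1 : HasSum (fun z : Fin d → ℤ => kdelta x z * S z y) (S x y) := by
    have e : (fun z : Fin d → ℤ => kdelta x z * S z y) = fun z => if z = x then S x y else 0 := by
      funext z
      by_cases h : z = x
      · subst h; simp [kdelta]
      · have h' : x ≠ z := fun hxz => h hxz.symm
        simp [kdelta, h, h']
    rw [e]
    exact hasSum_ite_eq x (S x y)
  have h2 := summable_mul_of_col_bounded hk hδ y (fun z => hS z y) x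
  unfold compKer
  calc ∑' z, (kdelta (d := d) + k) x z * S z y = ∑' z, (kdelta x z * S z y + k x z * S z y) :=
        tsum_congr fun z => by rw [Pi.add_apply, Pi.add_apply, add_mul]
    _ = ∑' z, kdelta x z * S z y + ∑' z, k x z * S z y := h1.summable.tsum_add h2
    _ = S x y + ∑' z, k x z * S z y := by rw [h1.tsum_eq]

/-- **THE GREEN'S FUNCTION OF `δ + k` ON `ℤ^d` EXISTS, DECAYS AND IS BLOCK-PERIODIC** for a decaying perturbation `k`
(`|k(x,y)| ≤ θe^{−δ|x−y|₁}`, `δ > 0`) of the identity with `θ·K₁(d, δ∕2) < 1`: there is `S` with `(δ + k)∘S = δ`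
entrywise, `|S(x,y)| ≤ (1 − θK₁(δ∕2))⁻¹e^{−(δ∕2)|x−y|₁}`, and `S` is jointly `n`-periodic whenever `k` is — the Neumann
series *"(188) and Lemma 2.1"* read as the construction of an inverse; this is the labelled INPUT `compKer T S = kdelta` ∧
`Decay₂ S C δ` ∧ `IsPeriodic₂` of `Beta.EntrywiseVolumeLimit` (§4, the block-periodic Lemma 2.2.2 and `tendsto_torusGreen`)
DISCHARGED for `T = δ + k`. [cite: Balaban1985Variational, (188) p.308; Balaban1984PropagatorsII, Lemma 2.1 (2.54), (2.61) p.234] -/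
theorem exists_green_of_perturbation {k : Kernel₂ d} {θ δ : ℝ} (hk : Decay₂ k θ δ) (hδ : 0 < δ)
    (hq : θ * K₁ d (δ / 2) < 1) :
    ∃ S : Kernel₂ d, (∀ x y, compKer (kdelta + k) S x y = kdelta x y) ∧
      Decay₂ S ((1 - θ * K₁ d (δ / 2))⁻¹) (δ / 2) ∧
      (∀ n : ℕ, IsPeriodic₂ n k → IsPeriodic₂ n S) := by
  classical
  have hθ : 0 ≤ θ := hk.constant_nonneg
  have hKle : K₁ d δ ≤ K₁ d (δ / 2) := K₁_anti (by linarith) (by linarith)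
  have hq1 : θ * K₁ d δ < 1 := lt_of_le_of_lt (mul_le_mul_of_nonneg_left hKle hθ) hq
  have hdel : ∀ x y : Fin d → ℤ, |kdelta x y| ≤ 1 := fun x y => by
    unfold kdelta; split_ifs <;> simp
  obtain ⟨S, hfix, hB⟩ := exists_bounded_fix hk hδ hdel hq1
  -- the Kronecker kernel decays at every rate with constant 1
  have hdec : Decay₂ (kdelta (d := d)) 1 (δ - δ / 2) := fun x y => by
    unfold kdelta
    split_ifs with h
    · subst h; simp [B12Sec2to5.l1]
    · rw [abs_zero, one_mul]; exact (Real.exp_pos _).le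
  have hfixle : ∀ x y, |S x y| ≤ |kdelta x y| + |compKer k S x y| := fun x y => by
    have e : S x y = kdelta x y - compKer k S x y := by linear_combination hfix x y
    rw [e]; exact abs_sub _ _
  have hq2 : θ * K₁ d (δ - (δ - δ / 2)) < 1 := by
    have e : δ - (δ - δ / 2) = δ / 2 := by ring
    rwa [e]
  have hS := decay₂_neumann hk hdec hB (by linarith) (by linarith) hfixle hq2
  refine ⟨S, fun x y => ?_, ?_, fun n pk => isPeriodic₂_of_fix hk hδ pk (isPeriodic₂_kdelta n) hB hfix hq1⟩
  · rw [compKer_kdelta_add_left hk hδ hB]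
    exact hfix x y
  · have e : δ - (δ - δ / 2) = δ / 2 := by ring
    have e' : δ - δ / 2 = δ / 2 := by ring
    rw [e, one_mul, e'] at hS
    exact hS

/-! ## §4. [15] (68)–(73) at the kernel level: the piece `𝔡` (= 𝔇 = (δ∕δA′)D) is an OUTPUT too -/

/-- **(68) ⇒ (70) + (73) AT THE ℤ^d-KERNEL LEVEL: THE PIECE `𝔡` EXISTS, DECAYS AT ½δ₀ AND IS BLOCK-PERIODIC.**  [15] p. 288–289:
differentiating the fixed-point equation for `D(A′)` gives (68) `{I + L^jη⟨(δ∕δA)C_j(·), H⟩}𝔇(A′) = L^jη(δ∕δA)C_j(·)`, i.e.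
with the LOCAL kernel `c′ := L^jη(δ∕δA)C_j(L^jη(A′ − HD(A′)))` ([4] Prop. 5 ∕ (157): `|c′| ≤ θ_c e^{−δ₀|·|₁}`, any rate by
locality) and the propagator `H` of (45)–(46) (`|h| ≤ A_He^{−δ₀|·|₁}`): `𝔡 + (c′∘h)∘𝔡 = c′`; *"Equation (68) is uniquely
solvable by a convergent Neumann series"* (70) with the kernel bound (71) *"which follows from Lemma 2.1 [3]"*, whence the
decay (73) at rate ½δ₀.  HERE: under `q_D := θ_cA_H·K₁(δ₀−¾δ₀)·K₁(¾δ₀−½δ₀) < 1` there is `𝔡` with that identity,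
`Decay₂ 𝔡 (θ_c(1−q_D)⁻¹) (δ₀∕2)` — print's ½δ₀ — and block-periodicity whenever `c′`, `h` are block-periodic; unique among
bounded kernels (`RemainderKernelNeumann.eq_of_fix`).  `exists_decaying_fix` with `k := c′∘h` (rate ¾δ₀,
`RemainderKernelDecay.decay₂_compKer`) and `s := c′`. [cite: Balaban1985Variational, (68) p.288, (70)–(73) p.289; Balaban1984PropagatorsII, Lemma 2.1 p.234] -/
theorem exists_eq68 {c' h : Kernel₂ d} {θc AH δ₀ : ℝ} (hc : Decay₂ c' θc δ₀) (hh : Decay₂ h AH δ₀) (hδ₀ : 0 < δ₀)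
    (hq : θc * AH * K₁ d (δ₀ - 3 * δ₀ / 4) * K₁ d (3 * δ₀ / 4 - δ₀ / 2) < 1) :
    ∃ 𝔡 : Kernel₂ d, (∀ x y, 𝔡 x y + compKer (compKer c' h) 𝔡 x y = c' x y) ∧
      Decay₂ 𝔡 (θc * (1 - θc * AH * K₁ d (δ₀ - 3 * δ₀ / 4) * K₁ d (3 * δ₀ / 4 - δ₀ / 2))⁻¹) (δ₀ / 2) ∧
      (∀ n : ℕ, IsPeriodic₂ n c' → IsPeriodic₂ n h → IsPeriodic₂ n 𝔡) := by
  have hk : Decay₂ (compKer c' h) (θc * AH * K₁ d (δ₀ - 3 * δ₀ / 4)) (3 * δ₀ / 4) :=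
    RemainderKernelDecay.decay₂_compKer hc hh (by linarith) (by linarith) (by linarith)
  have hs : Decay₂ c' θc (δ₀ / 2) := RemainderKernelDecay.decay₂_mono hc (by linarith)
  obtain ⟨𝔡, hfix, hdec, hper⟩ := exists_decaying_fix hk hs (by linarith) (by linarith) hq
  exact ⟨𝔡, hfix, hdec, fun n pc ph =>
    hper n (RemainderKernelPeriodised.isPeriodic₂_compKer pc ph) pc⟩

/-- **(73) FOR A GIVEN `𝔡`**: a bounded kernel `𝔡` obeying (68) `𝔡 + (c′∘h)∘𝔡 = c′` with `c′`, `h` as in `exists_eq68`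
decays at ½δ₀ with the same constant — `decay₂_neumann` with `k := c′∘h`, `s := c′`. [cite: Balaban1985Variational, (68) p.288, (70)–(73) p.289] -/
theorem decay₂_of_eq68 {c' h 𝔡 : Kernel₂ d} {θc AH Md δ₀ : ℝ} (hc : Decay₂ c' θc δ₀) (hh : Decay₂ h AH δ₀)
    (hδ₀ : 0 < δ₀) (hMd : ∀ x y, |𝔡 x y| ≤ Md) (h68 : ∀ x y, 𝔡 x y + compKer (compKer c' h) 𝔡 x y = c' x y)
    (hq : θc * AH * K₁ d (δ₀ - 3 * δ₀ / 4) * K₁ d (3 * δ₀ / 4 - δ₀ / 2) < 1) :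
    Decay₂ 𝔡 (θc * (1 - θc * AH * K₁ d (δ₀ - 3 * δ₀ / 4) * K₁ d (3 * δ₀ / 4 - δ₀ / 2))⁻¹) (δ₀ / 2) := by
  have hk : Decay₂ (compKer c' h) (θc * AH * K₁ d (δ₀ - 3 * δ₀ / 4)) (3 * δ₀ / 4) :=
    RemainderKernelDecay.decay₂_compKer hc hh (by linarith) (by linarith) (by linarith)
  have hs : Decay₂ c' θc (δ₀ / 2) := RemainderKernelDecay.decay₂_mono hc (by linarith)
  have hfixle : ∀ x y, |𝔡 x y| ≤ |c' x y| + |compKer (compKer c' h) 𝔡 x y| := fun x y => by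
    have e : 𝔡 x y = c' x y - compKer (compKer c' h) 𝔡 x y := by linear_combination h68 x y
    rw [e]; exact abs_sub _ _
  exact decay₂_neumann hk hs hMd (by linarith) (by linarith) hfixle hq

/-- **BLOCK-PERIODICITY OF A GIVEN `𝔡`** obeying (68) with block-periodic `c′`, `h` (same smallness). [cite: Balaban1985Variational, (68) p.288, (70)–(73) p.289] -/
theorem isPeriodic₂_of_eq68 {c' h 𝔡 : Kernel₂ d} {θc AH Md δ₀ : ℝ} {n : ℕ} (hc : Decay₂ c' θc δ₀)
    (hh : Decay₂ h AH δ₀) (hδ₀ : 0 < δ₀) (pc : IsPeriodic₂ n c') (ph : IsPeriodic₂ n h)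
    (hMd : ∀ x y, |𝔡 x y| ≤ Md) (h68 : ∀ x y, 𝔡 x y + compKer (compKer c' h) 𝔡 x y = c' x y)
    (hq : θc * AH * K₁ d (δ₀ - 3 * δ₀ / 4) * K₁ d (3 * δ₀ / 4 - δ₀ / 2) < 1) : IsPeriodic₂ n 𝔡 := by
  have hk : Decay₂ (compKer c' h) (θc * AH * K₁ d (δ₀ - 3 * δ₀ / 4)) (3 * δ₀ / 4) :=
    RemainderKernelDecay.decay₂_compKer hc hh (by linarith) (by linarith) (by linarith)
  have hnn : 0 ≤ θc * AH * K₁ d (δ₀ - 3 * δ₀ / 4) := hk.constant_nonneg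
  have hq' : θc * AH * K₁ d (δ₀ - 3 * δ₀ / 4) * K₁ d (3 * δ₀ / 4) < 1 :=
    lt_of_le_of_lt (mul_le_mul_of_nonneg_left (K₁_anti (by linarith) (by linarith)) hnn) hq
  exact isPeriodic₂_of_fix hk (by linarith) (RemainderKernelPeriodised.isPeriodic₂_compKer pc ph) pc hMd h68 hq'

end Literature.MathematicalPhysics.QuantumFieldTheory.Balaban1983to89.Beta.RemainderKernelNeumannExistence
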